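import Literature.MathematicalPhysics.QuantumFieldTheory.Balaban1983to89.B9Eq369CurvSmallZd

/-!
# `Balaban1983to89.B9Eq369CurvSmallZdCurvedWitness` — A GENUINELY CURVED INHABITANT OF B8's CLASS `𝔄_m({Ω_j}, α₀)` ((1.7)∕(1.9)) ON THE `ℤᵈ × 𝔸`
# CARRIER: the constant-curvature abelian background `U₀(x, μ) = c^{x_{μ₀}}·1` on the `μ₁`-bonds (`|c| = 1`), whose plaquette variables are `c^{±1}` on the
# `(μ₀, μ₁)`-plaquettes and `1` elsewhere — so the hypothesis class of `B9Eq369CurvSmallZd` (p584031: (3.69) for the genuine `Δ′(U₀)` in `InAk`-currency) is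
# inhabited by a NON-FLAT unitary configuration (referee dag-ref-L READ-10 NIT-1 «the curved inhabitant is true but not exhibited in-file» answered)

statement-level skeleton of published theorems with citation tags; proofs where landed; nothing here is a claim about the
Yang–Mills mass gap

PDF held: `paper:balaban1985-cmp99-regular-spaces-gauge-fixing` (B8; journal page = PDF page + 74), p. 77 (1.7), (1.9) (the class `𝔄_k({Ω_j}, α₀)`); p. 98
(«the configuration … identically equal to 1 satisfies, of course, all possible regularity conditions»); [Balaban1985BackgroundPropagators] p. 404 (3.69).
Quoted verbatim in `B8Ineq132` and `B9Eq369CurvSmallZd` — BY NAME.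

WHY THIS FILE (cell `pub-ymgap`, HUMAN RULING D-0062 ∕ D-0149; seat `pub-ymgap-dag-n06-w2` (g0), node N06 = [B9]; count-neutral).  p584031's A6 inhabitant
(`hypotheses_inhabited_one`) is the FLAT background, at which `Δ′ = 0` (`DpZd_one`) — degenerate, as dag-ref-L noted.  Here is a curved one, for EVERY
`C⋆`-algebra `𝔸`, every `d ≥ 2` (two distinct directions `μ₀ ≠ μ₁`) and every tolerance: the abelian field `c^{x_{μ₀}}` on the `μ₁`-bonds has holonomy `c`
around every `(μ₀, μ₁)`-plaquette (and `c⁻¹` ∕ `1` around the others), its plaquette field is CONSTANT and CENTRAL, hence covariantly divergence-free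
((1.9) with left side `0`), and `‖c^{±1} − 1‖ = ‖c − 1‖` can be made `< α₀L^{−2m}`.

WHAT IS PROVED (0 sorry; 2 defs).
* §1 `scalarUnitZd c` (the central unit `c·1` of `𝔸` from `c : ℂˣ`), `curvedCfg c μ₀ μ₁` (the field); `scalarUnitZd_val`, `scalarUnitZd_zpow_val`,
  `mem_unitary_algebraMap`, ★ `curvedCfg_unitary` (`|c| = 1` ⇒ unitary bond variables).
* §2 ★ `plaqF_curvedCfg` — THE HOLONOMY: `U₀(∂p_{κμ}(x)) = (c·1)^{[μ=μ₁][κ=μ₀] − [κ=μ₁][μ=μ₀]}` (exponent `∈ {−1, 0, 1}`, independent of `x`);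
  `plaqF_curvedCfg_self` (`= c·1` on the `(μ₀, μ₁)`-plaquettes: NOT flat for `c ≠ 1`), `norm_plaqF_curvedCfg_sub_one_le` (`≤ ‖c − 1‖`).
* §3 `covDeriv_const_algebraMap` (the covariant derivative of a constant central field vanishes), `covDiv_curvedCfg` (`D^{η*}_{U₀}∂U₀ = 0`).
* §4 ★★ `inAk_curvedCfg` — `‖c − 1‖ < α₀·L^{−2m}` (`L ≥ 1`, `η > 0`, `|c| = 1`) ⇒ `InAk L m η α₀ Ω (curvedCfg c μ₀ μ₁)` for EVERY `Ω`; `exists_unit_near_one`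
  (`∀ ε > 0, ∃ c : ℂˣ, |c| = 1 ∧ c ≠ 1 ∧ ‖c − 1‖ < ε`); ★★ `exists_curved_inAk` — for `μ₀ ≠ μ₁`, `α₀ > 0`: a unitary `U₀ ∈ 𝔄_m({Ω_j}, α₀)` whose
  `(μ₀, μ₁)`-plaquette variables are all `≠ 1`.

HONEST SCOPE.  An explicit abelian example (nothing of [B8]∕[B9] asserted); its purpose is A6 (non-degenerate inhabitation of p584031's hypothesis class);
count-neutral; N05 ∕ N06 NOT discharged; one finite lattice programme at fixed `ε`; R4 closes the conditional finite-𝕋⁴ rung `BalabanLadder.UV` only; nothing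
continuum ∕ ℝ⁴ ∕ OS ∕ mass-gap ∕ Clay.  Unit `pub-ymgap-dag-n06-w2` (g0), 2026-08-28.
-/

noncomputable section

namespace Literature.MathematicalPhysics.QuantumFieldTheory.Balaban1983to89.B9Eq369CurvSmallZdCurvedWitness

open B7Prop1Explicit (e hol plaqWord lplaqWord_true hol_lplaqWord)
open B7Prop2Explicit (unitaryUnits)
open B8Ineq132 (plaqF covDeriv covDiv InAk CondAt PlaqTouches BondTouches)

-- `Site` alone could resolve to the torus sites of `Setup.lean`; re-export the `ℤ^d` sites of `B7Prop1Explicit`.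
export B7Prop1Explicit (Site)

variable {d : ℕ} {𝔸 : Type*} [CStarAlgebra 𝔸]

/-! ## §1 The constant-curvature abelian background -/

/-- **the central unit `c·1` of `𝔸`** from a unit complex number `c`. [cite: Balaban1985RegularSpaces, p.76 §A (bond variables in the group)] -/
def scalarUnitZd (c : ℂˣ) : 𝔸ˣ := Units.map ((algebraMap ℂ 𝔸 : ℂ →+* 𝔸) : ℂ →* 𝔸) c

/-- its value. [cite: Balaban1985RegularSpaces, p.76 §A (bookkeeping)] -/
theorem scalarUnitZd_val (c : ℂˣ) : ((scalarUnitZd (𝔸 := 𝔸) c : 𝔸ˣ) : 𝔸) = algebraMap ℂ 𝔸 c := rfl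

/-- the value of its integer powers. [cite: Balaban1985RegularSpaces, p.76 §A (bookkeeping)] -/
theorem scalarUnitZd_zpow_val (c : ℂˣ) (n : ℤ) : (((scalarUnitZd (𝔸 := 𝔸) c) ^ n : 𝔸ˣ) : 𝔸) = algebraMap ℂ 𝔸 ((c ^ n : ℂˣ) : ℂ) := by
  unfold scalarUnitZd
  rw [← map_zpow]
  rfl

/-- **THE CONSTANT-CURVATURE ABELIAN FIELD**: `U₀(x, μ₁) = (c·1)^{x_{μ₀}}`, `U₀(x, μ) = 1` for `μ ≠ μ₁`.
[cite: Balaban1985RegularSpaces, (1.7) p.77 (an inhabitant of the class)] -/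
def curvedCfg (c : ℂˣ) (μ₀ μ₁ : Fin d) : Site d → Fin d → 𝔸ˣ :=
  fun x μ => (scalarUnitZd c) ^ (if μ = μ₁ then x μ₀ else 0 : ℤ)

/-- a unit complex number gives a unitary scalar. [cite: Balaban1985RegularSpaces, p.76 §A (bookkeeping)] -/
theorem mem_unitary_algebraMap {c : ℂ} (hc : ‖c‖ = 1) : algebraMap ℂ 𝔸 c ∈ unitary 𝔸 := by
  have h1 : star c * c = 1 := by
    rw [Complex.star_def, ← Complex.normSq_eq_conj_mul_self, Complex.normSq_eq_norm_sq, hc]; norm_num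
  have h2 : c * star c = 1 := by rw [mul_comm]; exact h1
  rw [Unitary.mem_iff]
  constructor
  · rw [← algebraMap_star_comm, ← map_mul, h1, map_one]
  · rw [← algebraMap_star_comm, ← map_mul, h2, map_one]

/-- ★ **the field is unitary** (`|c| = 1`). [cite: Balaban1985RegularSpaces, p.76 §A («U(b) ∈ G»)] -/
theorem curvedCfg_unitary {c : ℂˣ} (hc : ‖(c : ℂ)‖ = 1) (μ₀ μ₁ : Fin d) (x : Site d) (μ : Fin d) :
    curvedCfg (𝔸 := 𝔸) c μ₀ μ₁ x μ ∈ unitaryUnits 𝔸 := by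
  unfold curvedCfg
  refine Subgroup.zpow_mem _ ?_ _
  show ((scalarUnitZd (𝔸 := 𝔸) c : 𝔸ˣ) : 𝔸) ∈ unitary 𝔸
  rw [scalarUnitZd_val]
  exact mem_unitary_algebraMap hc

/-! ## §2 The holonomy: constant, central, `c^{±1}` or `1` -/

/-- ★ **THE PLAQUETTE VARIABLES OF THE CURVED FIELD**: `U₀(∂p_{κμ}(x)) = (c·1)^{[μ=μ₁][κ=μ₀] − [κ=μ₁][μ=μ₀]}` — independent of `x` (constant curvature).
[cite: Balaban1985RegularSpaces, (1.2) p.76, (1.7) p.77] -/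
theorem plaqF_curvedCfg (c : ℂˣ) (μ₀ μ₁ κ μ : Fin d) (x : Site d) :
    plaqF (curvedCfg (𝔸 := 𝔸) c μ₀ μ₁) κ μ x =
      (((scalarUnitZd (𝔸 := 𝔸) c) ^ ((if μ = μ₁ then (if κ = μ₀ then (1 : ℤ) else 0) else 0) -
          (if κ = μ₁ then (if μ = μ₀ then (1 : ℤ) else 0) else 0)) : 𝔸ˣ) : 𝔸) := by
  unfold plaqF
  rw [← lplaqWord_true, hol_lplaqWord]
  simp only [B7Prop1Explicit.stepHol_true, B7Prop1Explicit.Letter.vec_true, curvedCfg]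
  rw [← zpow_neg, ← zpow_neg, ← zpow_add, ← zpow_add, ← zpow_add]
  congr 2
  simp only [Pi.add_apply, B7Prop1Explicit.e_apply]
  split_ifs <;> omega

/-- **on the `(μ₀, μ₁)`-plaquettes the holonomy is `c·1`** (`μ₀ ≠ μ₁`): the field is NOT flat for `c ≠ 1`.
[cite: Balaban1985RegularSpaces, (1.7) p.77] -/
theorem plaqF_curvedCfg_self (c : ℂˣ) {μ₀ μ₁ : Fin d} (hμ : μ₀ ≠ μ₁) (x : Site d) :
    plaqF (curvedCfg (𝔸 := 𝔸) c μ₀ μ₁) μ₀ μ₁ x = algebraMap ℂ 𝔸 c := by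
  rw [plaqF_curvedCfg]
  have h : ((if μ₁ = μ₁ then (if μ₀ = μ₀ then (1 : ℤ) else 0) else 0) -
      (if μ₀ = μ₁ then (if μ₁ = μ₀ then (1 : ℤ) else 0) else 0)) = 1 := by
    simp [hμ]
  rw [h, zpow_one, scalarUnitZd_val]

/-- the exponent of the holonomy is `−1`, `0` or `1`. [cite: Balaban1985RegularSpaces, (1.7) p.77 (bookkeeping)] -/
theorem holonomyExponent_trichotomy (μ₀ μ₁ κ μ : Fin d) :
    ((if μ = μ₁ then (if κ = μ₀ then (1 : ℤ) else 0) else 0) - (if κ = μ₁ then (if μ = μ₀ then (1 : ℤ) else 0) else 0)) = -1 ∨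
    ((if μ = μ₁ then (if κ = μ₀ then (1 : ℤ) else 0) else 0) - (if κ = μ₁ then (if μ = μ₀ then (1 : ℤ) else 0) else 0)) = 0 ∨
    ((if μ = μ₁ then (if κ = μ₀ then (1 : ℤ) else 0) else 0) - (if κ = μ₁ then (if μ = μ₀ then (1 : ℤ) else 0) else 0)) = 1 := by
  split_ifs <;> simp

/-- `‖c^{n} − 1‖ ≤ ‖c − 1‖` for a unit complex number and `n ∈ {−1, 0, 1}`. [cite: Balaban1985RegularSpaces, (1.7) p.77 (bookkeeping)] -/
theorem norm_units_zpow_sub_one_le {c : ℂˣ} (hc : ‖(c : ℂ)‖ = 1) {n : ℤ} (hn : n = -1 ∨ n = 0 ∨ n = 1) :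
    ‖((c ^ n : ℂˣ) : ℂ) - 1‖ ≤ ‖(c : ℂ) - 1‖ := by
  rcases hn with rfl | rfl | rfl
  · have hc0 : (c : ℂ) ≠ 0 := c.ne_zero
    have h : ((c ^ (-1 : ℤ) : ℂˣ) : ℂ) - 1 = (c : ℂ)⁻¹ * (1 - (c : ℂ)) := by
      rw [zpow_neg, zpow_one, Units.val_inv_eq_inv_val, mul_sub, mul_one, inv_mul_cancel₀ hc0]
    rw [h, norm_mul, norm_inv, hc, inv_one, one_mul, norm_sub_rev]
  · simp
  · simp

/-- ★ **the plaquette variables are within `‖c − 1‖` of `1`** everywhere. [cite: Balaban1985RegularSpaces, (1.7) p.77] -/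
theorem norm_plaqF_curvedCfg_sub_one_le [Nontrivial 𝔸] {c : ℂˣ} (hc : ‖(c : ℂ)‖ = 1) (μ₀ μ₁ κ μ : Fin d) (x : Site d) :
    ‖plaqF (curvedCfg (𝔸 := 𝔸) c μ₀ μ₁) κ μ x - 1‖ ≤ ‖(c : ℂ) - 1‖ := by
  rw [plaqF_curvedCfg, scalarUnitZd_zpow_val, ← map_one (algebraMap ℂ 𝔸), ← map_sub, norm_algebraMap']
  exact norm_units_zpow_sub_one_le hc (holonomyExponent_trichotomy μ₀ μ₁ κ μ)

/-! ## §3 The plaquette field is covariantly divergence-free -/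

/-- **the covariant derivative of a constant central field vanishes** (any bond variables). [cite: Balaban1985RegularSpaces, (1.1) p.76] -/
theorem covDeriv_const_algebraMap (η : ℝ) (V : Site d → Fin d → 𝔸ˣ) (ν : Fin d) (a : ℂ) (x : Site d) :
    covDeriv η V ν (fun _ => algebraMap ℂ 𝔸 a) x = 0 := by
  simp only [B8Ineq132.covDeriv, B7Eq78Linearization.conjR_apply]
  rw [← Algebra.commutes, mul_assoc, Units.mul_inv, mul_one, sub_self, smul_zero]

/-- **`D^{η*}_{U₀}∂U₀ = 0` for the curved field** — (1.9) holds with left side `0`. [cite: Balaban1985RegularSpaces, (1.9) p.77, (1.2) p.76] -/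
theorem covDiv_curvedCfg (η : ℝ) (c : ℂˣ) (μ₀ μ₁ μ : Fin d) (x : Site d) : covDiv η (curvedCfg (𝔸 := 𝔸) c μ₀ μ₁) μ x = 0 := by
  unfold covDiv
  have h : ∀ κ ν : Fin d, (plaqF (curvedCfg (𝔸 := 𝔸) c μ₀ μ₁) κ ν) = fun _ => algebraMap ℂ 𝔸
      (((c ^ ((if ν = μ₁ then (if κ = μ₀ then (1 : ℤ) else 0) else 0) -
          (if κ = μ₁ then (if ν = μ₀ then (1 : ℤ) else 0) else 0)) : ℂˣ) : ℂ)) := by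
    intro κ ν; funext y; rw [plaqF_curvedCfg, scalarUnitZd_zpow_val]
  simp only [h, covDeriv_const_algebraMap, Finset.sum_const_zero, sub_self]

/-! ## §4 The curved field lies in `𝔄_m({Ω_j}, α₀)` -/

/-- ★★ **`U₀ ∈ 𝔄_m({Ω_j}, α₀)` FOR THE CURVED FIELD** whenever `‖c − 1‖ < α₀·L^{−2m}` (`L ≥ 1`, `η > 0`, `|c| = 1`; every `Ω`): (1.7) from §2, (1.9) from §3.
[cite: Balaban1985RegularSpaces, (1.7), (1.9) p.77] -/
theorem inAk_curvedCfg [Nontrivial 𝔸] {L : ℕ} (hL : 1 ≤ L) (m : ℕ) {η : ℝ} (hη : 0 < η) {α : ℝ} {c : ℂˣ} (hc : ‖(c : ℂ)‖ = 1)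
    (hsmall : ‖(c : ℂ) - 1‖ < α * (((L : ℝ) ^ m)⁻¹) ^ 2) (Ω : ℕ → Set (Site d)) (μ₀ μ₁ : Fin d) :
    InAk L m η α Ω (curvedCfg (𝔸 := 𝔸) c μ₀ μ₁) := by
  have hL1 : (1 : ℝ) ≤ (L : ℝ) := by exact_mod_cast hL
  have hLpos : (0 : ℝ) < (L : ℝ) := by linarith
  have hα : 0 < α := by
    have h0 : (0 : ℝ) < α * (((L : ℝ) ^ m)⁻¹) ^ 2 := (norm_nonneg _).trans_lt hsmall
    have hp : (0 : ℝ) < (((L : ℝ) ^ m)⁻¹) ^ 2 := by positivity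
    exact pos_of_mul_pos_left (by simpa [mul_comm] using h0) hp.le
  intro j hj
  have hmono : α * (((L : ℝ) ^ m)⁻¹) ^ 2 ≤ α * (((L : ℝ) ^ j)⁻¹) ^ 2 := by
    have h1 : ((L : ℝ) ^ j) ≤ (L : ℝ) ^ m := pow_le_pow_right₀ hL1 hj
    have h2 : ((L : ℝ) ^ m)⁻¹ ≤ ((L : ℝ) ^ j)⁻¹ := inv_anti₀ (by positivity) h1
    have h3 : (0 : ℝ) ≤ ((L : ℝ) ^ m)⁻¹ := by positivity
    gcongr
  refine ⟨fun x μ ν _ _ => (norm_plaqF_curvedCfg_sub_one_le hc μ₀ μ₁ μ ν x).trans_lt (hsmall.trans_le hmono), fun x μ _ => ?_⟩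
  rw [covDiv_curvedCfg, norm_zero]
  positivity

/-- **unit complex numbers arbitrarily close to, but different from, `1`**: `c = e^{it}`, `t = min(ε∕2, 1)`.
[cite: Balaban1985RegularSpaces, (1.7) p.77 (bookkeeping)] -/
theorem exists_unit_near_one {ε : ℝ} (hε : 0 < ε) : ∃ c : ℂˣ, ‖(c : ℂ)‖ = 1 ∧ (c : ℂ) ≠ 1 ∧ ‖(c : ℂ) - 1‖ < ε := by
  set t : ℝ := min (ε / 2) 1 with ht
  have ht0 : 0 < t := lt_min (by linarith) one_pos
  have ht1 : t ≤ 1 := min_le_right _ _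
  have htε : t ≤ ε / 2 := min_le_left _ _
  have hne : Complex.exp (Complex.I * t) ≠ 0 := Complex.exp_ne_zero _
  refine ⟨Units.mk0 _ hne, ?_, ?_, ?_⟩
  · rw [Units.val_mk0, mul_comm, Complex.norm_exp_ofReal_mul_I]
  · rw [Units.val_mk0]
    intro h
    obtain ⟨n, hn⟩ := Complex.exp_eq_one_iff.1 h
    have h2 : ((t : ℝ) : ℂ) = (((n : ℝ) * (2 * Real.pi) : ℝ) : ℂ) := by
      apply mul_right_cancel₀ Complex.I_ne_zero
      push_cast
      linear_combination hn
    have him : t = (n : ℝ) * (2 * Real.pi) := Complex.ofReal_inj.1 h2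
    have hpi : (3 : ℝ) < Real.pi := Real.pi_gt_three
    rcases lt_trichotomy n 0 with hn0 | hn0 | hn0
    · have : (n : ℝ) ≤ -1 := by exact_mod_cast Int.le_sub_one_iff.2 hn0
      nlinarith
    · rw [hn0] at him; simp at him; linarith
    · have : (1 : ℝ) ≤ (n : ℝ) := by exact_mod_cast hn0
      nlinarith
  · rw [Units.val_mk0]
    calc ‖Complex.exp (Complex.I * t) - 1‖ ≤ ‖t‖ := Real.norm_exp_I_mul_ofReal_sub_one_le
      _ = t := Real.norm_of_nonneg ht0.le
      _ < ε := by linarith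

/-- ★★ **A GENUINELY CURVED MEMBER OF `𝔄_m({Ω_j}, α₀)`** (`d ≥ 2`: two distinct directions; `α₀ > 0`; `L ≥ 1`, `η > 0`; every `C⋆`-algebra `𝔸`): a unitary
`U₀` in the class whose `(μ₀, μ₁)`-plaquette variables are all `≠ 1` — the non-degenerate inhabitant of the hypothesis class of `B9Eq369CurvSmallZd`'s
(3.69)-currency theorems (dag-ref-L READ-10 NIT-1). [cite: Balaban1985RegularSpaces, (1.7), (1.9) p.77; Balaban1985BackgroundPropagators, (3.69) p.404] -/
theorem exists_curved_inAk [Nontrivial 𝔸] {L : ℕ} (hL : 1 ≤ L) (m : ℕ) {η : ℝ} (hη : 0 < η) {α : ℝ} (hα : 0 < α)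
    (Ω : ℕ → Set (Site d)) {μ₀ μ₁ : Fin d} (hμ : μ₀ ≠ μ₁) :
    ∃ U₀ : Site d → Fin d → 𝔸ˣ, (∀ x κ, U₀ x κ ∈ unitaryUnits 𝔸) ∧ InAk L m η α Ω U₀ ∧ ∀ x : Site d, plaqF U₀ μ₀ μ₁ x ≠ 1 := by
  have hε : 0 < α * (((L : ℝ) ^ m)⁻¹) ^ 2 := by
    have : (0 : ℝ) < (L : ℝ) := by exact_mod_cast hL
    positivity
  obtain ⟨c, hc1, hcne, hcε⟩ := exists_unit_near_one hε
  refine ⟨curvedCfg c μ₀ μ₁, fun x κ => curvedCfg_unitary hc1 μ₀ μ₁ x κ, inAk_curvedCfg hL m hη hc1 hcε Ω μ₀ μ₁, fun x h => hcne ?_⟩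
  rw [plaqF_curvedCfg_self c hμ x, ← map_one (algebraMap ℂ 𝔸)] at h
  have hn : ‖algebraMap ℂ 𝔸 ((c : ℂ) - 1)‖ = 0 := by rw [map_sub, h, sub_self, norm_zero]
  rw [norm_algebraMap', norm_eq_zero, sub_eq_zero] at hn
  exact hn

end Literature.MathematicalPhysics.QuantumFieldTheory.Balaban1983to89.B9Eq369CurvSmallZdCurvedWitness

end
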